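import Mathlib.Analysis.Complex.Circle
import Literature.IUT.HodgeArakelov.KummerPrimeStripsNonVacuity

/-!
# [IUTchII] Definition 4.9 (v)/(vi): non-vacuity of the archimedean local datum and of the local
# data `‡F^{⊢▶×μ}_v` at every type of place (companion to `KummerPrimeStrips.lean`, theorem-only)

S. Mochizuki, *Inter-universal Teichmüller theory II*, §4, Definition 4.9 (v) p. 157 ("the units
`(‡D^⊢_w)^×` … form a topological group [noncanonically isomorphic to `S¹`] … related to the above
inductive system of units via a system of compatible surjections `(‡D^⊢_w)^× ↠ O^{×μ_N}(A)` [i.e., where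
the kernel … is the subgroup of `N`-torsion]") and (vi) p. 157 (the local data by type of place)
[cite: Mochizuki2012, Def 4.9 (v) p.157]. Claim key DISPUTED (D-0012): nothing here asserts a disputed
claim or takes a side on [IUTchIII] Cor 3.12. PROOF-ONLY companion (abc-iut cell, layer L6, nodes
**IUTchII:Def4.9(v)**/(vi); WAVE-3 seat abc-iut-L6-d7): no new definitions.

**What is shown.**
* `nonempty_archimedeanKummerData`: for ANY commutative group `U` (as the monoid `O^▷(A)`), the
  projections `U ↠ U^×/μ_N` form an `ArchimedeanKummerData U` with "circle" `U` itself: surjective,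
  compatible with the transition maps `O^{×μ_N} ↠ O^{×μ_M}` (`N ∣ M`), kernel = the `N`-torsion —
  the printed shape of Def 4.9 (v). `nonempty_archimedeanKummerData_circle` is the HONEST instance
  `U = S¹ ⊆ ℂ` (Mathlib `Circle`), "noncanonically isomorphic to `S¹`" taken literally.
* `nonempty_archTriMuDatum_circle`: the archimedean local datum `ArchTriMuDatum` is inhabited (by `S¹`).
* `nonempty_localTriMuDatum`: for EVERY place type `k` (bad / good nonarchimedean / archimedean), every
  `l` and every group `G`, SOME group-theoretic-units datum `X` admits a `LocalTriMuDatum l G X k` —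
  nonarchimedean cases from `nonempty_nonarchTriMuDatum` (DVR split monoid `ℤ_{(p)}`-style, here any
  DVR `R`), archimedean case from `S¹`.
These certify joint satisfiability of abc-iut-L6-t2's interface fields; they model neither the
anabelian content of the Kummer structures nor the archimedean Frobenioid of [IUTchI] Ex 3.4.
-/

namespace Literature.IUT.HodgeArakelov

open scoped nonZeroDivisors

universe u v

section Archimedean

/-- **IUTchII:Def4.9(v)** (kurims p.157) For any commutative group `U`, the quotient maps
`U ↠ U^×/μ_N(U)` ("compatible surjections … where the kernel … is the subgroup of `N`-torsion") form an
`ArchimedeanKummerData U` whose "circle" is `U` — non-vacuity of the interface in the printed shape.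
[cite: Mochizuki2012, Def 4.9 (v) p.157] -/
theorem nonempty_archimedeanKummerData (U : Type v) [CommGroup U] :
    Nonempty (ArchimedeanKummerData.{v, v} U) := by
  refine ⟨{ circle := CommGrpCat.of U,
            proj := fun N => (QuotientGroup.mk' (rootsOfUnity N U)).comp (toUnits (G := U)).toMonoidHom,
            proj_surjective := fun N _ => ?_,
            proj_compatible := fun {N M} h => ?_,
            ker_proj := fun N z _ => ?_ }⟩
  · intro q
    induction q using QuotientGroup.induction_on with
    | H x => exact ⟨((toUnits (G := U)).symm x : U), by simp⟩
  · ext z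
    rfl
  · show QuotientGroup.mk' (rootsOfUnity N U) (toUnits (z : U)) = 1 ↔ z ^ N = 1
    rw [QuotientGroup.mk'_apply, QuotientGroup.eq_one_iff, mem_rootsOfUnity, ← map_pow,
      ← (toUnits (G := U)).map_one, (toUnits (G := U)).injective.eq_iff]

/-- **IUTchII:Def4.9(v)** (kurims p.157) The HONEST instance: the circle group `S¹ ⊆ ℂ` with its
projections `S¹ ↠ S¹/μ_N` is an `ArchimedeanKummerData S¹` ("noncanonically isomorphic to `S¹`").
[cite: Mochizuki2012, Def 4.9 (v) p.157] -/
theorem nonempty_archimedeanKummerData_circle : Nonempty (ArchimedeanKummerData.{0, 0} Circle) :=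
  nonempty_archimedeanKummerData Circle

/-- **IUTchII:Def4.9(v)** (kurims p.157) The archimedean local datum `‡F^{⊢▶×μ}_w` (`ArchTriMuDatum`: monoid,
splitting image, circle with projections) is inhabited, with monoid and circle `S¹` and trivial
splitting image. [cite: Mochizuki2012, Def 4.9 (v) p.157] -/
theorem nonempty_archTriMuDatum_circle : Nonempty ArchTriMuDatum.{0} := by
  obtain ⟨K⟩ := nonempty_archimedeanKummerData_circle
  exact ⟨⟨CommMonCat.of Circle, ⊥, K⟩⟩

/-- **IUTchII:Def4.9(v)** (kurims p.157) Universe-polymorphic form: for any commutative group `U` the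
archimedean local datum is inhabited with monoid and circle `U`. [cite: Mochizuki2012, Def 4.9 (v) p.157] -/
theorem nonempty_archTriMuDatum (U : Type v) [CommGroup U] : Nonempty ArchTriMuDatum.{v} := by
  obtain ⟨K⟩ := nonempty_archimedeanKummerData U
  exact ⟨⟨CommMonCat.of U, ⊥, K⟩⟩

end Archimedean

section Local

variable {R : Type v} [CommRing R] [IsDomain R] [IsDiscreteValuationRing R]
variable (G : Type u) [Group G]

/-- **IUTchII:Def4.9(vi)** (kurims p.157) For EVERY type of place `k` — (a) `v ∈ V^bad`, (b)
`v ∈ V^good ∩ V^non`, (c) `v ∈ V^arc` — every `l` and every group `G`, some group-theoretic-units datum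
`X` admits a local datum `LocalTriMuDatum l G X k`: cases (a)/(b) by the DVR split monoid of
`nonempty_nonarchTriMuDatum` (given any discrete valuation ring `R` in the units' universe), case (c)
by the commutative group `(R⁰)ˣ` standing in for the circle (any commutative group works,
`nonempty_archTriMuDatum`; the honest `S¹` instance is `nonempty_archTriMuDatum_circle`).
[cite: Mochizuki2012, Def 4.9 (vi) p.157] -/
theorem nonempty_localTriMuDatum (l : ℕ) (k : PlaceKind) {ϖ : R} (hϖ : Irreducible ϖ) :
    ∃ X : GroupTheoreticUnits.{u, v} G, Nonempty (LocalTriMuDatum.{u, v, v} l G X k) := by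
  cases k with
  | bad =>
    obtain ⟨X, ⟨D⟩⟩ := nonempty_nonarchTriMuDatum (R := R) G l PlaceKind.bad hϖ
    exact ⟨X, ⟨.bad D⟩⟩
  | goodNonarch =>
    obtain ⟨X, ⟨D⟩⟩ := nonempty_nonarchTriMuDatum (R := R) G l PlaceKind.goodNonarch hϖ
    exact ⟨X, ⟨.good D⟩⟩
  | arch =>
    obtain ⟨X, -⟩ := nonempty_nonarchTriMuDatum (R := R) G l PlaceKind.bad hϖ
    obtain ⟨D⟩ := nonempty_archTriMuDatum (R⁰)ˣ
    exact ⟨X, ⟨.arch D⟩⟩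

end Local

end Literature.IUT.HodgeArakelov
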